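import Mathlib
import HarnessLib
import Summits.ResolutionOfSingularities.ResolutionOfSingularities.Theorems.WildQuotientsWildQuotientResolutionJordanFiveSeamsAppLE
import Summits.ResolutionOfSingularities.ResolutionOfSingularities.Theorems.WildQuotientsWildQuotientResolutionJordanFiveChartW1Ring
import Summits.ResolutionOfSingularities.ResolutionOfSingularities.Theorems.WildQuotientsWildQuotientResolutionJordanFiveI12Stable
import Summits.ResolutionOfSingularities.ResolutionOfSingularities.Theorems.WildQuotientsWildQuotientResolutionJordanFourBrickH1W
import Summits.ResolutionOfSingularities.ResolutionOfSingularities.Theorems.WildQuotientsWildQuotientResolutionJordanFiveRingBrickOne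

/-!
# RUNG V5 (J₅): the ring-level brick `H₁` at `W₁ = chartW₁` (hypothesis `H₁` of `JordanFive.coneBrick_one_of_ringBrick`)

(crux stmt-ResolutionOfSingularities-15640 `WildQuotients.WildQuotientResolution`, line `Sketch`;
chain w45c RUNG V5, scaffold `JordanFive.jordanFive_hasResolution_of_bricks` (res-L1-w45c-lead-1),
`L/w45c/CHAIN.md` v8.4 §4: brick `H₁` = res-L1-w45c-stub-1. [OURS · L1 W4.5c] — NOT a statement of
any manuscript (Hironaka 2017 is consumed nowhere); replaces the role of no printed item. Prover
res-L1-w45c-stub-1. AI-written Lean, kernel-checked; weaker than expert review.)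

`JordanFive.brickH1`: VERBATIM the hypothesis `H₁` of lead-1's adapter
`JordanFive.coneBrick_one_of_ringBrick` (file `…JordanFiveRingBrickOne.lean`), under the J₅ law
`σ : x_b ↦ x_b + x_a, x_c ↦ x_c + x_b, x_d ↦ x_d + x_c, x_e ↦ x_e + x_d`, `σ x_i = x_i` otherwise
(so the extra scalars `hbe hce hde he` precede the binder's own quantifiers and
`brickH1 p hp hp5 k n σ a b c d e hab … he hσ` IS the term `H₁`): for every affine-quotient action
`ρ`, every lifted action `ρB` on `Bl_{I₁₂} 𝔸ⁿ → 𝔸ⁿ → 𝔸ⁿ/⟨σ⟩`, every stable affine open `O = chartW₁`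
and all chart ratios `T_j` (`T_j · π^*H′² = π^*g_j`, `j ≠ 1`) there are `R₀`, a radical `J₀ ⊆ R₀` with
regular affine blow-up and an injective `ψ : R₀ → Γ(O)` onto the invariants with
`√(ψ⁻¹⟨π^*x_a, π^*x_b, π^*x_c, π^*x_d, T_j⟩) = J₀`.

Assembly (the J₄ `brickH1W` recipe, p519150): the seam in `appLE` spelling
`exists_sectionsEquiv_chartW₁_appLE` (res-L1-w45c-stub-5) ∘ `JordanFour.ringBrick_transport` ∘ this
seat's ring side `exists_ringBrick_X1_chartW₁` (stub-2's X1 model p531492 + the `eE` engine instance).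
`JordanFive.brickHP1` := `coneBrick_one_of_ringBrick … (brickH1 …)` — the scheme-level cone brick `HP₁`
itself (the binder `HP₁` of lead-1's scaffold′ `jordanFive_hasResolution_of_bricks'`, p536385).
-/

-- single-problem summit: the doubled namespace component `ResolutionOfSingularities` is forced
set_option linter.dupNamespace false

noncomputable section

open CategoryTheory AlgebraicGeometry TopologicalSpace MvPolynomial HomogeneousLocalization
open Literature.AlgebraicGeometry.Resolution Literature.AlgebraicGeometry.RelativeSpec
open scoped Pointwise

namespace Summit.ResolutionOfSingularities.ResolutionOfSingularities.Theorems.WildQuotientResolution.JordanFive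

-- the statement is the literal `H₁` binder of `coneBrick_one_of_ringBrick` (large chart terms): head-room
set_option maxHeartbeats 8000000 in
/-- **The ring-level brick `H₁` of the RUNG V5 scaffold at `W₁ = chartW₁`** = hypothesis `H₁` of
`JordanFive.coneBrick_one_of_ringBrick` verbatim, after the scalars; see the module docstring.
[OURS · L1 W4.5c] [folklore; assembly of landed decls: seam ∘ transport ∘ ring side] -/
theorem brickH1 (p : ℕ) (hp : p.Prime) (hp5 : 5 ≤ p)
    (k : Type) [Field k] [CharP k p] (n : ℕ)
    (σ : MvPolynomial (Fin n) k ≃ₐ[k] MvPolynomial (Fin n) k) [Finite ↥(Subgroup.zpowers σ)]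
    (a b c d e : Fin n) (hab : a ≠ b) (hac : a ≠ c) (had : a ≠ d) (hae : a ≠ e) (hbc : b ≠ c)
    (hbd : b ≠ d) (hbe : b ≠ e) (hcd : c ≠ d) (hce : c ≠ e) (hde : d ≠ e)
    (hb : σ (X b) = X b + X a) (hc : σ (X c) = X c + X b) (hd : σ (X d) = X d + X c)
    (he : σ (X e) = X e + X d)
    (hσ : ∀ i, i ≠ b → i ≠ c → i ≠ d → i ≠ e → σ (X i) = X i)
  (ρ : ↥(Subgroup.zpowers σ) →* Aut (Spec (CommRingCat.of (MvPolynomial (Fin n) k))))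
    (hρ : ∀ g : ↥(Subgroup.zpowers σ), (ρ g).hom = Spec.map (CommRingCat.ofHom
      ((MulSemiringAction.toRingEquiv (↥(Subgroup.zpowers σ)) (MvPolynomial (Fin n) k) g⁻¹ :
        MvPolynomial (Fin n) k ≃+* MvPolynomial (Fin n) k) :
          MvPolynomial (Fin n) k →+* MvPolynomial (Fin n) k)))
    (ρB : ActionOver
      (affineBlowup.π (I12 k n a b c d) ≫
        Spec.map (CommRingCat.ofHom (algebraMap
          (FixedPoints.subalgebra k (MvPolynomial (Fin n) k) (Subgroup.zpowers σ))
          (MvPolynomial (Fin n) k))))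
      ↥(Subgroup.zpowers σ))
    (hρB : ρB.aut = (affineBlowup.isBlowup (I12 k n a b c d)).liftAction ρ
      (idealSheaf_I12_comap k n a b c d hab hac had hbc hbd hcd σ (hσ a hab hac had hae) hb hc hd
        ρ hρ))
    (O : ρB.StableAffineOpens) (hO : O.1 = chartW₁ k n a b c d)
    (hle : ((O.1.ι ≫ affineBlowup.π (I12 k n a b c d) ≫
        Spec.map (CommRingCat.ofHom (algebraMap
          (FixedPoints.subalgebra k (MvPolynomial (Fin n) k) (Subgroup.zpowers σ))
          (MvPolynomial (Fin n) k)))) ⁻¹ᵁ ⊤ : (O.1 : Scheme.{0}).Opens) ≤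
      O.1.ι ⁻¹ᵁ blowupChart (affineBlowup.π (I12 k n a b c d))
        (affineBlowup.idealSheaf (I12 k n a b c d)) ⟨⊤, isAffineOpen_top _⟩
        ((Scheme.ΓSpecIso (CommRingCat.of (MvPolynomial (Fin n) k))).inv.hom (JordanFour.hPrime k n a b c ^ 2)))
    (T : {j : Fin 40 // j ≠ 1} →
      Γ(affineBlowup (I12 k n a b c d), blowupChart (affineBlowup.π (I12 k n a b c d))
        (affineBlowup.idealSheaf (I12 k n a b c d)) ⟨⊤, isAffineOpen_top _⟩
        ((Scheme.ΓSpecIso (CommRingCat.of (MvPolynomial (Fin n) k))).inv.hom (JordanFour.hPrime k n a b c ^ 2))))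
    (hT : ∀ j, (affineBlowup.π (I12 k n a b c d)).appLE ⊤
          (blowupChart (affineBlowup.π (I12 k n a b c d))
            (affineBlowup.idealSheaf (I12 k n a b c d)) ⟨⊤, isAffineOpen_top _⟩
            ((Scheme.ΓSpecIso (CommRingCat.of (MvPolynomial (Fin n) k))).inv.hom (JordanFour.hPrime k n a b c ^ 2)))
          (blowupChart_le_preimage _ _ _ _)
          ((Scheme.ΓSpecIso (CommRingCat.of (MvPolynomial (Fin n) k))).inv.hom
            (gens12 k n a b c d j.1)) =
        (affineBlowup.π (I12 k n a b c d)).appLE ⊤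
          (blowupChart (affineBlowup.π (I12 k n a b c d))
            (affineBlowup.idealSheaf (I12 k n a b c d)) ⟨⊤, isAffineOpen_top _⟩
            ((Scheme.ΓSpecIso (CommRingCat.of (MvPolynomial (Fin n) k))).inv.hom (JordanFour.hPrime k n a b c ^ 2)))
          (blowupChart_le_preimage _ _ _ _)
          ((Scheme.ΓSpecIso (CommRingCat.of (MvPolynomial (Fin n) k))).inv.hom (JordanFour.hPrime k n a b c ^ 2)) * T j) :
    ∃ (R₀ : Type) (_ : CommRing R₀) (J₀ : Ideal R₀)
      (ψ : R₀ →+* Γ((O.1 : Scheme.{0}), (O.1.ι ≫ affineBlowup.π (I12 k n a b c d) ≫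
        Spec.map (CommRingCat.ofHom (algebraMap
          (FixedPoints.subalgebra k (MvPolynomial (Fin n) k) (Subgroup.zpowers σ))
          (MvPolynomial (Fin n) k)))) ⁻¹ᵁ ⊤)),
      Function.Injective ψ ∧ ψ.range = (ρB.restrict O.1 O.2.1).invariantsRing ⊤ ∧
      J₀.IsRadical ∧ Scheme.IsRegular (affineBlowup J₀) ∧
      ((Ideal.span ((O.1.ι.appLE
          (blowupChart (affineBlowup.π (I12 k n a b c d))
            (affineBlowup.idealSheaf (I12 k n a b c d)) ⟨⊤, isAffineOpen_top _⟩
            ((Scheme.ΓSpecIso (CommRingCat.of (MvPolynomial (Fin n) k))).inv.hom (JordanFour.hPrime k n a b c ^ 2)))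
          ((O.1.ι ≫ affineBlowup.π (I12 k n a b c d) ≫
            Spec.map (CommRingCat.ofHom (algebraMap
              (FixedPoints.subalgebra k (MvPolynomial (Fin n) k) (Subgroup.zpowers σ))
              (MvPolynomial (Fin n) k)))) ⁻¹ᵁ ⊤) hle) ''
        (((affineBlowup.π (I12 k n a b c d)).appLE ⊤
            (blowupChart (affineBlowup.π (I12 k n a b c d))
              (affineBlowup.idealSheaf (I12 k n a b c d)) ⟨⊤, isAffineOpen_top _⟩
              ((Scheme.ΓSpecIso (CommRingCat.of (MvPolynomial (Fin n) k))).inv.hom (JordanFour.hPrime k n a b c ^ 2)))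
            (blowupChart_le_preimage _ _ _ _)) ''
          ((Scheme.ΓSpecIso (CommRingCat.of (MvPolynomial (Fin n) k))).inv ''
            {X a, X b, X c, X d}) ∪ Set.range T))).comap ψ).radical = J₀ := by
  have Hseam := exists_sectionsEquiv_chartW₁_appLE k n σ a b c d e hab hac had hae hb hc hd hσ
    (smul_I12_eq k n a b c d hab hac had hbc hbd hcd σ (hσ a hab hac had hae) hb hc hd) ρ hρ
    (idealSheaf_I12_comap k n a b c d hab hac had hbc hbd hcd σ (hσ a hab hac had hae) hb hc hd ρ hρ)
    ρB hρB O hO hle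
  rcases Hseam with ⟨φ, hP, Ω, hφ, hbase, -, hinv⟩
  exact JordanFour.ringBrick_transport _ _ _ _ Ω hbase _ _ hinv (JordanFour.hPrime k n a b c ^ 2) _
    ({X a, X b, X c, X d} : Set (MvPolynomial (Fin n) k)) T hT
    (fun t ht => exists_ringBrick_X1_chartW₁ k n a b c d e p hp hp5 σ hab hac had hae hbc hbd hbe
      hcd hce hde hb hc hd he hσ φ hφ hP t ht)

-- large literal binders
set_option maxHeartbeats 8000000 in
/-- **The `μ₃` cone brick `HP₁` of the RUNG V5 scaffold at `W₁ = chartW₁`, DISCHARGED**: lead-1's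
adapter `coneBrick_one_of_ringBrick` applied to `brickH1` (its type is that adapter's conclusion
verbatim; it is the binder `HP₁` of `jordanFive_hasResolution_of_bricks'` at
`hJ := idealSheaf_I12_comap …`, `W₁ := chartW₁ …`). [OURS · L1 W4.5c] [folklore; one application] -/
theorem brickHP1 (p : ℕ) (hp : p.Prime) (hp5 : 5 ≤ p)
    (k : Type) [Field k] [CharP k p] (n : ℕ)
    (σ : MvPolynomial (Fin n) k ≃ₐ[k] MvPolynomial (Fin n) k) [Finite ↥(Subgroup.zpowers σ)]
    (a b c d e : Fin n) (hab : a ≠ b) (hac : a ≠ c) (had : a ≠ d) (hae : a ≠ e) (hbc : b ≠ c)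
    (hbd : b ≠ d) (hbe : b ≠ e) (hcd : c ≠ d) (hce : c ≠ e) (hde : d ≠ e)
    (hb : σ (X b) = X b + X a) (hc : σ (X c) = X c + X b) (hd : σ (X d) = X d + X c)
    (he : σ (X e) = X e + X d)
    (hσ : ∀ i, i ≠ b → i ≠ c → i ≠ d → i ≠ e → σ (X i) = X i) :
    ∀ (ρ : ↥(Subgroup.zpowers σ) →* Aut (Spec (CommRingCat.of (MvPolynomial (Fin n) k))))
      (hρ : ∀ g : ↥(Subgroup.zpowers σ), (ρ g).hom = Spec.map (CommRingCat.ofHom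
        ((MulSemiringAction.toRingEquiv (↥(Subgroup.zpowers σ)) (MvPolynomial (Fin n) k) g⁻¹ :
          MvPolynomial (Fin n) k ≃+* MvPolynomial (Fin n) k) :
            MvPolynomial (Fin n) k →+* MvPolynomial (Fin n) k)))
      (ρB : ActionOver
        (affineBlowup.π (I12 k n a b c d) ≫
          Spec.map (CommRingCat.ofHom (algebraMap
            (FixedPoints.subalgebra k (MvPolynomial (Fin n) k) (Subgroup.zpowers σ))
            (MvPolynomial (Fin n) k))))
        ↥(Subgroup.zpowers σ))
      (_ : ρB.aut = (affineBlowup.isBlowup (I12 k n a b c d)).liftAction ρ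
        (idealSheaf_I12_comap k n a b c d hab hac had hbc hbd hcd σ (hσ a hab hac had hae) hb hc hd
          ρ hρ))
      (O : ρB.StableAffineOpens) (_ : O.1 = chartW₁ k n a b c d)
      (Z : Closeds (ρB.pieceQuot O)),
      (Z : Set (ρB.pieceQuot O)) =
        (ρB.pieceMk O).base '' (O.1.ι.base ⁻¹' vertexCurve k n a b c d 1) →
      ∃ (B : Scheme.{0}) (pB : B ⟶ ρB.pieceQuot O),
        IsBlowup pB (Scheme.IdealSheafData.vanishingIdeal Z) ∧ Scheme.IsRegular B :=
  coneBrick_one_of_ringBrick p hp hp5 k n σ a b c d e hab hac had hae hbc hbd hcd hb hc hd hσ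
    (brickH1 p hp hp5 k n σ a b c d e hab hac had hae hbc hbd hbe hcd hce hde hb hc hd he hσ)

end Summit.ResolutionOfSingularities.ResolutionOfSingularities.Theorems.WildQuotientResolution.JordanFive

end
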